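import Summits.BirchSwinnertonDyer.Rank1Residual.X9.IwasawaLowerBoundRankOne
import Summits.BirchSwinnertonDyer.Rank1Residual.X9.IwasawaLowerBoundJetchev
import HarnessLib

/-!
# Class X9, analytic rank `≤ 1`: closures of the rank-one Iwasawa lower bound — Cha / Jetchev–Cha
# index certificates in either rank, and the `μ`-typing `BSD(E,p) ⟺ μ(X(E/ℚ_∞)) = 0` in rank one
# (cell `b2b-bsdres`, unit `b2b-bsdres-x9`, gen 10; continuation of `X9/IwasawaLowerBoundRankOne.lean`)

HONEST FRAMING (run/shared/lean/b2b/bsd-rank1-residual/, verbatim in every file): the goal of the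
cell is to DELETE the COMBINATION-SHAPED residual classes of the Birch–Swinnerton-Dyer formula for
ALL analytic-rank `≤ 1` elliptic curves over `ℚ` — "full BSD formula for every rank `≤ 1` curve in
class `C`" assembled STRICTLY from published theorems — so that the rank-`≤ 1` remainder becomes
exactly the CONSTRUCTION-SHAPED classes, which are TYPED (missing-input `Prop`s), NOT attempted.
This is not "finishing BSD". Theorems only; NO named fact is introduced; X9's label (typed) is not
changed; no pair is booked by this file (the lane books, the referee rules).

## Contents (our own compositions, hence `Summits/`)

* `bsdp_of_cha_of_unitCoeff_of_analyticRank_le_one`, `bsdp_of_classX9_of_cha_of_unitCoeff_of_analyticRank_le_one`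
  — UPPER = Cha 2005 (Miller 2011 Thm. 5.2, stated for `r_an ≤ 1`) with an index certificate, LOWER =
  `missingLowerBoundAt_of_unitCoeff_of_analyticRank_le_one` (BCS 2025 Thm. 1.1.2 (a) + one unit
  coefficient of `𝓛_p(E)`; in rank 1 also Perrin-Riou–Schneider, Perrin-Riou 1987 and the Schneider
  certificate): `BSD(E,p)` per certified pair in EITHER rank;
* `bsdp_of_classX9_of_millerJetchev_of_unitCoeff_of_analyticRank_le_one` — the Jetchev–Cha variant
  (Miller Thm. 5.4 under Cha's hypotheses, flag `Miller11-Thm54-Cha-case`);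
* `mu_eq_zero_of_bsdp_of_analyticRank_eq_one` — rank 1, CONVERSE: `BSD(E,p)` + certificates ⟹
  Greenberg's `μ(X(E/ℚ_∞)) = 0` (the exponent `k` of BCS (a) is `0`); with gen 5's forward direction
  `bsdp_iff_mu_eq_zero_of_classX9_of_analyticRank_eq_one` / `…_le_one`: on class X9 the typed
  residue IS the conjecture instance `μ = 0`, pair by pair, in BOTH ranks.

## References

* [BurungaleCastellaSkinner2025] IMRN 2025 = arXiv:2405.00270v2, Thm. 1.1.2 (a) (p. 2).
* [BalakrishnanMullerStein2015] Math. Comp. 85 (2016), Thm. 1.7 (Perrin-Riou–Schneider).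
* [PerrinRiou1987] Invent. Math. 89 (1987), §1.4 Cor. 1.8.
* [GreenbergLNM1716] LNM 1716 (1999), §1 Conj. 1.11, Thm. 4.1 (p. 102).
* [Miller2011LMS] LMS J. Comput. Math. 14 (2011), Thms. 5.2, 5.4, Def. 1.1.
-/

set_option autoImplicit false

noncomputable section

open scoped Classical MatrixGroups ModularForm

open CongruenceSubgroup WeierstrassCurve Literature.NumberTheory.EllipticCurves
  Literature.NumberTheory.EllipticCurves.ModularForms Literature.NumberTheory.EllipticCurves.Rank1Residual
  Literature.NumberTheory.EllipticCurves.Miller2011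

namespace Summit.BirchSwinnertonDyer.Rank1Residual.X9

variable (W : WeierstrassCurve ℚ) [W.IsElliptic] [W.IsGloballyMinimal] (p : ℕ) [Fact p.Prime]

section Closure

variable {N : ℕ} [NeZero N] {K : Type} [Field K] [NumberField K]

/-- **Rank `≤ 1`: `BSD(E,p)` from Cha's index bound (UPPER) and the Iwasawa lower bound (LOWER)** —
rank-`≤ 1` form of gen 9's `bsdp_of_cha_of_unitCoeff_of_analyticRank_eq_zero` (Cha 2005 = Miller
Thm. 5.2 is stated for `r_an ≤ 1`).  Class-free: `E` non-CM, `p ≥ 5` good ordinary, `E[p]`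
irreducible; Heegner datum `(K, P)`, index certificate `ord_p [E(K) : ℤP] ≤ k`, `#Ш_an = q` with
`2k ≤ ord_p q`; certificates `hcert` and (rank 1) `hSch`. [cite: Miller2011LMS, Thm. 5.2 and Def. 1.1]
[cite: BurungaleCastellaSkinner2025, Thm. 1.1.2 (a) (p. 2 of arXiv:2405.00270v2)] -/
theorem bsdp_of_cha_of_unitCoeff_of_analyticRank_le_one
    (hBCS : burungale_castella_skinner_charIdeal_eq_padicLFunction)
    (hGr : greenberg_charValue_rankZero) (h5 : realPeriodRat_eq_unit_mul_plusPeriod)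
    (hS : Schneider1985_order_charGenerator) (hPR : perrinRiou_rankOne_leadingTerms)
    (hmodP : nonempty_modularParametrizationData) (hmodL : hasEntireLFunction_rat)
    (hGZK : rank_eq_analyticRank_of_analyticRank_le_one)
    (hCha : Cha2005.thm52_padicValNat_shaOrder_le)
    (hcm : ¬ W.HasCM) (hp : 5 ≤ p) (hord : GoodOrd W p) (hirr : Irr W p) (hr : W.analyticRank ≤ 1)
    (hK : IsImaginaryQuadratic K) (hH : SatisfiesHeegnerHypothesis N K)
    {P : (W.baseChange K).toAffine.Point} (hP : IsHeegnerPoint N W K P) (hnt : ¬ IsOfFinAddOrder P)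
    (hpD : ¬ (p : ℤ) ∣ NumberField.discr K) (hpN : ¬ p ^ 2 ∣ N)
    {k : ℕ} (hI : padicValNat p (AddSubgroup.zmultiples P).index ≤ k)
    {q : ℚ} (hq : shaAn W = (q : ℂ)) (hv : (2 * k : ℤ) ≤ padicValRat p q)
    (hSch : W.analyticRank = 1 → ∀ Dh : PAdicHeightData W p, Dh.IsCanonical → SchneiderConjecture Dh)
    (hcert : ∀ [NeZero (W.conductorNorm ℤ)] (f : CuspForm (Gamma0 (W.conductorNorm ℤ)) 2),
        IsNewformOf W f → ∀ (ϖ : ℚ), (ϖ : ℝ) * W.realPeriodRat = plusPeriod f →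
      ∃ n : ℕ, ‖PowerSeries.coeff n
        (PowerSeries.C (ϖ : ℚ_[p]) * padicLFunction f (unitRoot W p : ℚ_[p]))‖ = 1) :
    BSDp W p := by
  have hp2 : p ≠ 2 := by omega
  exact Typed.bsdp_of_missingPPartAt W p hGZK hr
    (Typed.missingPPartAt_of_lower_of_upper W p
      (missingLowerBoundAt_of_unitCoeff_of_analyticRank_le_one W p hBCS hGr h5 hS hPR hmodP hmodL hGZK
        hp hord hirr hr hSch hcert)
      (Typed.missingUpperBoundAt_of_cha_of_index_le W p hCha hcm hr hK hH hP hnt hp2 hpD hpN hirr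
        hI hq hv))

/-- **Class X9, rank `≤ 1`: `BSD(E,p)` at a pair carrying the Heegner-index certificate, the
`μ(𝓛_p(E)) = 0` certificate and (rank 1) the Schneider certificate** (non-CM, `p ≥ 5` good
ordinary, `E[p]` irreducible AUTOMATIC from `ClassX9`).  Per pair; not a class theorem.
[cite: Miller2011LMS, Thm. 5.2 and Def. 1.1] -/
theorem bsdp_of_classX9_of_cha_of_unitCoeff_of_analyticRank_le_one
    (hBCS : burungale_castella_skinner_charIdeal_eq_padicLFunction)
    (hGr : greenberg_charValue_rankZero) (h5 : realPeriodRat_eq_unit_mul_plusPeriod)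
    (hS : Schneider1985_order_charGenerator) (hPR : perrinRiou_rankOne_leadingTerms)
    (hmodP : nonempty_modularParametrizationData) (hmodL : hasEntireLFunction_rat)
    (hGZK : rank_eq_analyticRank_of_analyticRank_le_one)
    (hCha : Cha2005.thm52_padicValNat_shaOrder_le)
    (hX9 : ClassX9 W p) (hr : W.analyticRank ≤ 1)
    (hK : IsImaginaryQuadratic K) (hH : SatisfiesHeegnerHypothesis N K)
    {P : (W.baseChange K).toAffine.Point} (hP : IsHeegnerPoint N W K P) (hnt : ¬ IsOfFinAddOrder P)
    (hpD : ¬ (p : ℤ) ∣ NumberField.discr K) (hpN : ¬ p ^ 2 ∣ N)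
    {k : ℕ} (hI : padicValNat p (AddSubgroup.zmultiples P).index ≤ k)
    {q : ℚ} (hq : shaAn W = (q : ℂ)) (hv : (2 * k : ℤ) ≤ padicValRat p q)
    (hSch : W.analyticRank = 1 → ∀ Dh : PAdicHeightData W p, Dh.IsCanonical → SchneiderConjecture Dh)
    (hcert : ∀ [NeZero (W.conductorNorm ℤ)] (f : CuspForm (Gamma0 (W.conductorNorm ℤ)) 2),
        IsNewformOf W f → ∀ (ϖ : ℚ), (ϖ : ℝ) * W.realPeriodRat = plusPeriod f →
      ∃ n : ℕ, ‖PowerSeries.coeff n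
        (PowerSeries.C (ϖ : ℚ_[p]) * padicLFunction f (unitRoot W p : ℚ_[p]))‖ = 1) :
    BSDp W p :=
  bsdp_of_cha_of_unitCoeff_of_analyticRank_le_one W p hBCS hGr h5 hS hPR hmodP hmodL hGZK hCha hX9.1
    hX9.2.2.1 hX9.2.1 hX9.2.2.2.1 hr hK hH hP hnt hpD hpN hI hq hv hSch hcert

/-- **Class X9, rank `≤ 1`, Jetchev–Cha variant** (UPPER = Miller 2011 Thm. 5.4 under Cha's
hypotheses, flag `Miller11-Thm54-Cha-case`, index inflated by ONE Tamagawa number `c_q`, `q ∣ N`;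
LOWER = Iwasawa) — rank-`≤ 1` form of gen 9's `bsdp_of_classX9_of_millerJetchev_of_unitCoeff`.
[cite: Miller2011LMS, Thm. 5.4 and Def. 1.1] -/
theorem bsdp_of_classX9_of_millerJetchev_of_unitCoeff_of_analyticRank_le_one
    (hMJ : thm54_cha_padicValNat_shaOrder_add_tamagawa_le)
    (hBCS : burungale_castella_skinner_charIdeal_eq_padicLFunction)
    (hGr : greenberg_charValue_rankZero) (h5 : realPeriodRat_eq_unit_mul_plusPeriod)
    (hS : Schneider1985_order_charGenerator) (hPR : perrinRiou_rankOne_leadingTerms)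
    (hmodP : nonempty_modularParametrizationData) (hmodL : hasEntireLFunction_rat)
    (hGZK : rank_eq_analyticRank_of_analyticRank_le_one)
    (hX9 : ClassX9 W p) (hr : W.analyticRank ≤ 1)
    (hK : IsImaginaryQuadratic K) (hH : SatisfiesHeegnerHypothesis N K)
    {P : (W.baseChange K).toAffine.Point} (hP : IsHeegnerPoint N W K P) (hnt : ¬ IsOfFinAddOrder P)
    (q : ℕ) [Fact q.Prime] (hqN : q ∣ N)
    (hpD : ¬ (p : ℤ) ∣ NumberField.discr K) (hpN : ¬ p ^ 2 ∣ N) {k : ℕ}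
    (hI : padicValNat p (AddSubgroup.zmultiples P).index ≤
      k + padicValNat p ((W.baseChange ℚ_[q]).localTamagawaNumber ℤ_[q]))
    {s : ℚ} (hs : shaAn W = (s : ℂ)) (hv : (2 * k : ℤ) ≤ padicValRat p s)
    (hSch : W.analyticRank = 1 → ∀ Dh : PAdicHeightData W p, Dh.IsCanonical → SchneiderConjecture Dh)
    (hcert : ∀ [NeZero (W.conductorNorm ℤ)] (f : CuspForm (Gamma0 (W.conductorNorm ℤ)) 2),
        IsNewformOf W f → ∀ (ϖ : ℚ), (ϖ : ℝ) * W.realPeriodRat = plusPeriod f →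
      ∃ n : ℕ, ‖PowerSeries.coeff n
        (PowerSeries.C (ϖ : ℚ_[p]) * padicLFunction f (unitRoot W p : ℚ_[p]))‖ = 1) :
    BSDp W p := by
  obtain ⟨hcm, hord, hp, hirr, -, -⟩ := id hX9
  have hp2 : p ≠ 2 := by omega
  have hup : padicValNat p W.shaOrder ≤ 2 * (k + padicValNat p
      ((W.baseChange ℚ_[q]).localTamagawaNumber ℤ_[q]) -
      padicValNat p ((W.baseChange ℚ_[q]).localTamagawaNumber ℤ_[q])) :=
    padicValNat_shaOrder_le_of_index_sub_tamagawa hMJ W hK hH hP hnt p q hqN hcm hp2 hpD hpN hirr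
      hr hI le_rfl
  have hup' : padicValNat p W.shaOrder ≤ 2 * k := by omega
  have hU : Typed.MissingUpperBoundAt W p := by
    refine ⟨s, hs, le_trans ?_ hv⟩
    exact_mod_cast hup'
  exact Typed.bsdp_of_missingPPartAt W p hGZK hr
    (Typed.missingPPartAt_of_lower_of_upper W p
      (missingLowerBoundAt_of_unitCoeff_of_analyticRank_le_one W p hBCS hGr h5 hS hPR hmodP hmodL hGZK
        hp hord hirr hr hSch hcert) hU)

end Closure

/-! ### The `μ`-typing in rank one: `BSD(E,p) ⟺ μ(X(E/ℚ_∞)) = 0`, granted the certificates -/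

/-- **Analytic rank 1, CONVERSE: `BSD(E,p)` + the two certificates ⟹ Greenberg's `μ(X(E/ℚ_∞)) = 0`
for every cyclotomic dual datum.**  Class-free (`p ≥ 5` good ordinary, `E[p]` irreducible, any image):
BCS (a) gives `char X = (g)`, `ι g = p^k L_p(f, α)` for the newform `f` of modularity; the rank-one
chain gives `ord_p #Ш_an + k = ord_p #Ш`, Miller's `BSDp W p` gives `ord_p #Ш_an = ord_p #Ш[p^∞] =
ord_p #Ш`; so `k = 0`, `ι g = L_p(f, α)`, and the unit coefficient of `L_p` is a unit coefficient of
`g`: `μ = 0` (`mu_eq_zero_of_charIdeal_eq`).  Rank-one analogue of gen 5's `X9.mu_eq_zero_of_bsdp`.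
[cite: GreenbergLNM1716, §1 Conj. 1.11] [cite: Miller2011LMS, Def. 1.1]
[cite: BalakrishnanMullerStein2015, Thm. 1.7] [cite: PerrinRiou1987, §1.4 Cor. 1.8] -/
theorem mu_eq_zero_of_bsdp_of_analyticRank_eq_one
    (hBCS : burungale_castella_skinner_charIdeal_eq_padicLFunction)
    (h5 : realPeriodRat_eq_unit_mul_plusPeriod)
    (hS : Schneider1985_order_charGenerator) (hPR : perrinRiou_rankOne_leadingTerms)
    (hmodP : nonempty_modularParametrizationData)
    (hGZK : rank_eq_analyticRank_of_analyticRank_le_one)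
    (hp : 5 ≤ p) (hord : GoodOrd W p) (hirr : Irr W p) (hr : W.analyticRank = 1) (hbsd : BSDp W p)
    (hSch : ∀ Dh : PAdicHeightData W p, Dh.IsCanonical → SchneiderConjecture Dh)
    (hcert : ∀ [NeZero (W.conductorNorm ℤ)] (f : CuspForm (Gamma0 (W.conductorNorm ℤ)) 2),
        IsNewformOf W f → ∀ (ϖ : ℚ), (ϖ : ℝ) * W.realPeriodRat = plusPeriod f →
      ∃ n : ℕ, ‖PowerSeries.coeff n
        (PowerSeries.C (ϖ : ℚ_[p]) * padicLFunction f (unitRoot W p : ℚ_[p]))‖ = 1) :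
    ∀ (κ : ZpExtension ℚ p) (γ : Field.absoluteGaloisGroup ℚ),
        κ.IsCyclotomic → κ.IsTopGenerator γ → IsCyclotomicVariable p γ →
      ∀ (D : W.SelmerDualData κ γ), D.mu = 0 := by
  intro κ γ hκ hγ hγ' D
  obtain ⟨hgood, hordp⟩ := hord
  haveI : Finite W.sha := (hGZK W (by omega)).2
  -- the newform and the period ratio
  haveI : NeZero (W.conductorNorm ℤ) := ⟨(W.conductorNorm_pos_holds).ne'⟩
  obtain ⟨Dm⟩ := hmodP W
  have hf : IsNewformOf W Dm.f := Dm.isNewformOf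
  obtain ⟨ϖ, -, hϖeq, -⟩ := Dm.exists_rat_mul_realPeriodRat_eq_plusPeriod
  have hϖnorm : ‖(ϖ : ℚ_[p])‖ = 1 := norm_periodRatio_eq_one h5 W p hp hgood hirr Dm.f hf ϖ hϖeq
  have hϖv : padicValRat p ϖ = 0 := padicValRat_periodRatio_eq_zero W p h5 hp hgood hirr Dm.f hf ϖ hϖeq
  obtain ⟨Dh, hDh, -⟩ := existsUnique_isCanonical_holds W p hp hgood hordp
  -- BCS (a) for `(κ, γ, f, D)` and the chain with exponent `k`
  obtain ⟨hX, g, k, hchar, hιg⟩ := hBCS W p κ γ Dm.f hp hgood hordp hirr hκ hγ hγ' hf D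
  obtain ⟨s, hsha, -, hval⟩ := padicValRat_shaAn_add_exponent_of_analyticRank_eq_one hS hPR hGZK W p
    hp hgood hordp hr hκ hγ hγ' hf ϖ hϖeq hϖv Dh hDh (hSch Dh hDh) D hX g k hchar hιg
  -- `BSDp W p`: the same without `k`
  obtain ⟨-, -, q', hsha', hvq'⟩ := hbsd
  have hqq : q' = s := by exact_mod_cast hsha'.symm.trans hsha
  rw [hqq, padicValNat_card_addPrimaryComponent (A := W.sha) p] at hvq'
  simp only [WeierstrassCurve.shaOrder] at hval
  have hk : k = 0 := by linarith
  -- `k = 0`: `μ = 0` from the certificate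
  rw [hk, zpow_zero, map_one, one_mul] at hιg
  obtain ⟨n, hn⟩ := hcert Dm.f hf ϖ hϖeq
  rw [PowerSeries.coeff_C_mul, norm_mul, hϖnorm, one_mul] at hn
  exact mu_eq_zero_of_charIdeal_eq hγ D hX g hchar _ hιg ⟨n, hn⟩

/-- **Class X9, analytic rank 1: `BSD(E,p)` is EQUIVALENT to Greenberg's `μ = 0` for `(E, p)`**,
granted the two finite certificates and the PUBLISHED inputs BCS 2025 Thm. 1.1.2 (a),
Perrin-Riou–Schneider, Perrin-Riou 1987, the period unit, modularity and GZK (`→` above; `←` gen 5's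
`X9.bsdp_of_mu_eq_zero_of_analyticRank_eq_one`).  With gen 5's rank-0 `X9.bsdp_iff_mu_eq_zero`: the
typed residue of class X9 IS this conjecture instance, pair by pair, in both ranks.
[cite: GreenbergLNM1716, §1 Conj. 1.11] [cite: BurungaleCastellaSkinner2025, Thm. 1.1.2 (a) (p. 2 of arXiv:2405.00270v2)]
[cite: PerrinRiou1987, §1.4 Cor. 1.8] -/
theorem bsdp_iff_mu_eq_zero_of_classX9_of_analyticRank_eq_one
    (hBCS : burungale_castella_skinner_charIdeal_eq_padicLFunction)
    (h5 : realPeriodRat_eq_unit_mul_plusPeriod)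
    (hS : Schneider1985_order_charGenerator) (hPR : perrinRiou_rankOne_leadingTerms)
    (hmodP : nonempty_modularParametrizationData)
    (hGZK : rank_eq_analyticRank_of_analyticRank_le_one)
    (hX9 : ClassX9 W p) (hr : W.analyticRank = 1)
    (hSch : ∀ Dh : PAdicHeightData W p, Dh.IsCanonical → SchneiderConjecture Dh)
    (hcert : ∀ [NeZero (W.conductorNorm ℤ)] (f : CuspForm (Gamma0 (W.conductorNorm ℤ)) 2),
        IsNewformOf W f → ∀ (ϖ : ℚ), (ϖ : ℝ) * W.realPeriodRat = plusPeriod f →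
      ∃ n : ℕ, ‖PowerSeries.coeff n
        (PowerSeries.C (ϖ : ℚ_[p]) * padicLFunction f (unitRoot W p : ℚ_[p]))‖ = 1) :
    BSDp W p ↔
      ∀ (κ : ZpExtension ℚ p) (γ : Field.absoluteGaloisGroup ℚ),
        κ.IsCyclotomic → κ.IsTopGenerator γ → IsCyclotomicVariable p γ →
      ∀ (D : W.SelmerDualData κ γ), D.mu = 0 :=
  ⟨fun hbsd => mu_eq_zero_of_bsdp_of_analyticRank_eq_one W p hBCS h5 hS hPR hmodP hGZK hX9.2.2.1
      hX9.2.1 hX9.2.2.2.1 hr hbsd hSch hcert,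
    fun hμ => X9.bsdp_of_mu_eq_zero_of_analyticRank_eq_one W p hBCS h5 hS hPR hmodP hGZK hX9 hr hμ
      hcert hSch⟩

/-- **Class X9, analytic rank `≤ 1`: `BSD(E,p) ⟺ μ(X(E/ℚ_∞)) = 0`**, granted the certificates
(Schneider's only in rank 1) and the published binders (Greenberg Thm. 4.1 `hGr` and `hmodL` serve
rank 0, Perrin-Riou–Schneider `hS` and Perrin-Riou `hPR` serve rank 1).
[cite: GreenbergLNM1716, §1 Conj. 1.11 and Thm. 4.1 (p. 102)] [cite: PerrinRiou1987, §1.4 Cor. 1.8] -/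
theorem bsdp_iff_mu_eq_zero_of_classX9_of_analyticRank_le_one
    (hBCS : burungale_castella_skinner_charIdeal_eq_padicLFunction)
    (hGr : greenberg_charValue_rankZero) (h5 : realPeriodRat_eq_unit_mul_plusPeriod)
    (hS : Schneider1985_order_charGenerator) (hPR : perrinRiou_rankOne_leadingTerms)
    (hmodP : nonempty_modularParametrizationData) (hmodL : hasEntireLFunction_rat)
    (hGZK : rank_eq_analyticRank_of_analyticRank_le_one)
    (hX9 : ClassX9 W p) (hr : W.analyticRank ≤ 1)
    (hSch : W.analyticRank = 1 → ∀ Dh : PAdicHeightData W p, Dh.IsCanonical → SchneiderConjecture Dh)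
    (hcert : ∀ [NeZero (W.conductorNorm ℤ)] (f : CuspForm (Gamma0 (W.conductorNorm ℤ)) 2),
        IsNewformOf W f → ∀ (ϖ : ℚ), (ϖ : ℝ) * W.realPeriodRat = plusPeriod f →
      ∃ n : ℕ, ‖PowerSeries.coeff n
        (PowerSeries.C (ϖ : ℚ_[p]) * padicLFunction f (unitRoot W p : ℚ_[p]))‖ = 1) :
    BSDp W p ↔
      ∀ (κ : ZpExtension ℚ p) (γ : Field.absoluteGaloisGroup ℚ),
        κ.IsCyclotomic → κ.IsTopGenerator γ → IsCyclotomicVariable p γ →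
      ∀ (D : W.SelmerDualData κ γ), D.mu = 0 := by
  rcases Nat.le_one_iff_eq_zero_or_eq_one.mp hr with hr0 | hr1
  · exact X9.bsdp_iff_mu_eq_zero W p hBCS hGr h5 hmodP hmodL hGZK hX9 hr0 hcert
  · exact bsdp_iff_mu_eq_zero_of_classX9_of_analyticRank_eq_one W p hBCS h5 hS hPR hmodP hGZK hX9 hr1
      (hSch hr1) hcert

end Summit.BirchSwinnertonDyer.Rank1Residual.X9

end
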